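import Summits.QuantumFields.YangMills.Theorems.SwapVirialDeficitZeroModeGroupFourSmallBallDominatorFibre
import HarnessLib

/-!
# Exact zero-mode rung, FOUR pairwise nearly commuting letters — IV-c: the uniform dominating event has FINITE volume
# (zero-mode block of crux ⟨stmt-QuantumFields-24497⟩ `ToronTubeVolumeLaw`; free-hands support of ⟨stmt-QuantumFields-24197⟩ / ⟨24497⟩)

The majorant for dominated convergence in the two-scale family: ★★ `volume_domSet4_lt_top : vol³(domSet4) < ∞`, hence
★★ `volume_twoScaleSet4_le_domSet4` / `volume_twoScaleSet4_lt_top` — `vol³(T(η, ζ, κ)) ≤ vol³(domSet4) < ∞` UNIFORMLY in `η, ζ, κ ≥ 0`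
(in particular the limit volumes `h(κ) = vol³(T(0,0,κ))` of part III are finite).  The mechanism (why `ξ = x_I ∈ ℝ`, unbounded after the second
blow-up, integrates): over the reference letter `x` (largest transverse size `ρ² = tvSq x`), each other letter lives in `fibre4 x`, whose volume is
`≤ 16ρ` (trivially) AND `≤ 16√2/|x_I|` (the pair constraint confines its transverse part to a strip of width `∝ 1/|x_I|`, part IV-b, in the
coordinates ✓`coord4` of w2 g55); the square of `min(16ρ, 16√2/|x_I|)` integrates in `x_I ∈ ℝ` to `≤ (512 + 1024π)ρ` (§16, via
`∫(1 + x²)⁻¹ = π`), which is bounded on `tvSq x ≤ 1` (§17).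
HONEST LABEL: finite-dimensional measure theory on `SU(2)⁴` (plan-level zero-mode rung of DRAFT lines); NOT ⟨24497⟩, NOT ⟨24197⟩; the Yang–Mills mass gap
is NOT proved; no summit is proved by a line.  Seat ym-line-fcl-p3 g44 (cell ym-idea-1, free hands), `--supports stmt-QuantumFields-24197`.  Standard axioms (auxiliary measurable functions `Gb`, `gS`, `Hcoord`, window `okRef`).  References: [cite: GonzalezarroyoAltes1988]; [cite: Vanbaal2001]; [cite: Luscher1983, §2]; [folklore].
-/

set_option autoImplicit false

noncomputable section

open MeasureTheory Quaternion Set Real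
open scoped Quaternion ENNReal BigOperators
open Literature.MathematicalPhysics.QuantumLattice
open Summit.QuantumFields.YangMills.Theorems.SwapTwistDeficit.ToronLog

attribute [local instance] Literature.Analysis.FluidPDE.Tao2016.quatMeasurableSpace
  Literature.Analysis.FluidPDE.Tao2016.quatBorelSpace
  Literature.MathematicalPhysics.QuantumLattice.secondCountableTopology_su2

namespace Summit.QuantumFields.YangMills.Theorems.SwapVirialDeficit.ZeroModeGroup

/-! ## §16 The measurable fibre bound and its square integral in `x_I` -/

/-- The measurable fibre bound `Gb x = 16ρ` if `x_I²ρ² ≤ 1`, else `16√2/|x_I|`. [folklore] -/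
def Gb (x : ℍ) : ℝ≥0∞ :=
  if x.imI ^ 2 * tvSq x ≤ 1 then ENNReal.ofReal (16 * Real.sqrt (tvSq x)) else ENNReal.ofReal (16 * Real.sqrt 2 / |x.imI|)

/-- `vol(fibre4 x) ≤ Gb x`. [folklore] -/
theorem volume_fibre4_le_Gb (x : ℍ) : volume (fibre4 x) ≤ Gb x := by
  unfold Gb
  split_ifs with h
  · exact volume_fibre4_le_sqrt x
  · have hI : x.imI ≠ 0 := by intro h0; rw [h0] at h; simp at h
    exact volume_fibre4_le_inv hI

/-- The squared bound as a function of `(ξ, ρ²) = (x_I, tvSq x)`: `256ρ²` if `ξ²ρ² ≤ 1`, else `512/ξ²`. [folklore] -/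
def gS (ξ ρ2 : ℝ) : ℝ≥0∞ := if ξ ^ 2 * ρ2 ≤ 1 then ENNReal.ofReal (256 * ρ2) else ENNReal.ofReal (512 / ξ ^ 2)

/-- `gS` is jointly measurable. [folklore] -/
theorem measurable_gS : Measurable fun p : ℝ × ℝ => gS p.1 p.2 := by
  unfold gS
  refine Measurable.ite ?_ ?_ ?_
  · exact measurableSet_le ((measurable_fst.pow_const 2).mul measurable_snd) measurable_const
  · exact ENNReal.measurable_ofReal.comp (measurable_snd.const_mul _)
  · exact ENNReal.measurable_ofReal.comp (measurable_const.div (measurable_fst.pow_const 2))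

/-- `Gb x · Gb x = gS x_I (tvSq x)`. [folklore] -/
theorem Gb_mul_Gb (x : ℍ) : Gb x * Gb x = gS x.imI (tvSq x) := by
  unfold Gb gS
  split_ifs with h
  · rw [← ENNReal.ofReal_mul (by positivity)]
    congr 1
    have := Real.mul_self_sqrt (tvSq_nonneg x)
    nlinarith
  · have hI : x.imI ≠ 0 := by intro h0; rw [h0] at h; simp at h
    rw [← ENNReal.ofReal_mul (by positivity)]
    congr 1
    have h2 : Real.sqrt 2 * Real.sqrt 2 = 2 := Real.mul_self_sqrt (by norm_num)
    have h3 : |x.imI| * |x.imI| = x.imI ^ 2 := by rw [← sq, sq_abs]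
    field_simp
    nlinarith [h2, h3]

/-- The Cauchy profile integral: `∫ 1024ρ²/(ρ²ξ² + 1) dξ = 1024π·ρ` (`ρ = √ρ² > 0`). [folklore] -/
theorem integral_cauchy_profile {ρ2 : ℝ} (hρ : 0 < ρ2) :
    ∫ ξ : ℝ, 1024 * ρ2 / (ρ2 * ξ ^ 2 + 1) = 1024 * π * Real.sqrt ρ2 := by
  set ρ := Real.sqrt ρ2 with hρdef
  have hρpos : 0 < ρ := Real.sqrt_pos.2 hρ
  have hρ2 : ρ2 = ρ ^ 2 := (Real.sq_sqrt hρ.le).symm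
  have e : (fun ξ : ℝ => 1024 * ρ2 / (ρ2 * ξ ^ 2 + 1)) = fun ξ => (1024 * ρ2) * (fun y : ℝ => (1 + y ^ 2)⁻¹) (ρ * ξ) := by
    funext ξ
    have hden : ρ2 * ξ ^ 2 + 1 = 1 + (ρ * ξ) ^ 2 := by rw [hρ2]; ring
    simp only [hden, div_eq_mul_inv]
  rw [e, integral_const_mul, Measure.integral_comp_mul_left (fun y : ℝ => (1 + y ^ 2)⁻¹) ρ, integral_univ_inv_one_add_sq, smul_eq_mul,
    abs_of_pos (inv_pos.2 hρpos), hρ2]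
  field_simp

/-- ★ **The `x_I`-integral of the squared fibre bound**: `∫ gS(ξ, ρ²) dξ ≤ (512 + 1024π)·ρ`. [folklore] -/
theorem lintegral_gS_le {ρ2 : ℝ} (hρ : 0 ≤ ρ2) : ∫⁻ ξ : ℝ, gS ξ ρ2 ≤ ENNReal.ofReal ((512 + 1024 * π) * Real.sqrt ρ2) := by
  rcases hρ.eq_or_lt with h0 | hpos
  · -- `ρ² = 0`: `gS ≡ 0`
    have e : (fun ξ : ℝ => gS ξ ρ2) = fun _ => 0 := by
      funext ξ; unfold gS; rw [← h0]; simp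
    rw [e, lintegral_zero]; exact zero_le
  set ρ := Real.sqrt ρ2 with hρdef
  have hρpos : 0 < ρ := Real.sqrt_pos.2 hpos
  have hρsq : ρ * ρ = ρ2 := Real.mul_self_sqrt hpos.le
  -- pointwise majorant: `gS ≤ 256ρ²·𝟙_{[−1/ρ, 1/ρ]} + 1024ρ²/(ρ²ξ² + 1)`
  have hpt : ∀ ξ : ℝ, gS ξ ρ2 ≤ (Icc (-(1 / ρ)) (1 / ρ)).indicator (fun _ => ENNReal.ofReal (256 * ρ2)) ξ +
      ENNReal.ofReal (1024 * ρ2 / (ρ2 * ξ ^ 2 + 1)) := by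
    intro ξ
    unfold gS
    split_ifs with h
    · have hξ : ξ ∈ Icc (-(1 / ρ)) (1 / ρ) := by
        have h1 : (ξ * ρ) ^ 2 ≤ 1 := by rw [mul_pow, sq ρ, hρsq]; exact h
        have h2 : |ξ * ρ| ≤ 1 := by rw [← Real.sqrt_sq_eq_abs, ← Real.sqrt_one]; exact Real.sqrt_le_sqrt h1
        rw [abs_mul, abs_of_pos hρpos] at h2
        have h3 : |ξ| ≤ 1 / ρ := by rw [le_div_iff₀ hρpos]; exact h2
        obtain ⟨k1, k2⟩ := abs_le.1 h3
        exact ⟨k1, k2⟩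
      rw [Set.indicator_of_mem hξ]
      exact le_add_of_le_of_nonneg le_rfl (zero_le)
    · have hξ2 : 1 < ξ ^ 2 * ρ2 := not_le.1 h
      refine le_add_of_nonneg_of_le (zero_le) (ENNReal.ofReal_le_ofReal ?_)
      have hξpos : 0 < ξ ^ 2 := by nlinarith
      rw [div_le_div_iff₀ hξpos (by positivity)]
      nlinarith
  have hint : Integrable (fun ξ : ℝ => 1024 * ρ2 / (ρ2 * ξ ^ 2 + 1)) := by
    have e : (fun ξ : ℝ => 1024 * ρ2 / (ρ2 * ξ ^ 2 + 1)) = fun ξ => (1024 * ρ2) * (fun y : ℝ => (1 + y ^ 2)⁻¹) (ρ * ξ) := by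
      funext ξ
      have hden : ρ2 * ξ ^ 2 + 1 = 1 + (ρ * ξ) ^ 2 := by rw [← hρsq]; ring
      simp only [hden, div_eq_mul_inv]
    rw [e]; exact (integrable_inv_one_add_sq.comp_mul_left' hρpos.ne').const_mul _
  have hnn : 0 ≤ᵐ[volume] fun ξ : ℝ => 1024 * ρ2 / (ρ2 * ξ ^ 2 + 1) := Filter.Eventually.of_forall fun ξ => by positivity
  calc ∫⁻ ξ : ℝ, gS ξ ρ2 ≤ ∫⁻ ξ : ℝ, ((Icc (-(1 / ρ)) (1 / ρ)).indicator (fun _ => ENNReal.ofReal (256 * ρ2)) ξ +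
        ENNReal.ofReal (1024 * ρ2 / (ρ2 * ξ ^ 2 + 1))) := lintegral_mono hpt
    _ = ENNReal.ofReal (256 * ρ2) * volume (Icc (-(1 / ρ)) (1 / ρ)) + ∫⁻ ξ : ℝ, ENNReal.ofReal (1024 * ρ2 / (ρ2 * ξ ^ 2 + 1)) := by
        rw [lintegral_add_left (Measurable.indicator measurable_const measurableSet_Icc), lintegral_indicator measurableSet_Icc, setLIntegral_const]
    _ = ENNReal.ofReal (256 * ρ2) * ENNReal.ofReal (2 / ρ) + ENNReal.ofReal (1024 * π * ρ) := by
        rw [Real.volume_Icc, ← ofReal_integral_eq_lintegral_ofReal hint hnn, integral_cauchy_profile hpos]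
        congr 2; ring
    _ = ENNReal.ofReal ((512 + 1024 * π) * ρ) := by
        rw [← ENNReal.ofReal_mul (by positivity), ← ENNReal.ofReal_add (by positivity) (by positivity)]
        congr 1
        field_simp
        nlinarith [hρsq]

/-! ## §17 Assembly: `vol³(domRef)` and `vol³(domSet4)` are finite -/

/-- The reference-letter window `x₀² < 1`, `tvSq x ≤ 1`. [folklore] -/
def okRef : Set ℍ := {x | x.re ^ 2 < 1 ∧ tvSq x ≤ 1}

/-- `okRef` is measurable. [folklore] -/
theorem measurableSet_okRef : MeasurableSet okRef :=
  (measurableSet_re_sq_lt measurable_id).inter (measurableSet_tvSq_le measurable_id measurable_const)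

/-- `Gb` is measurable. [folklore] -/
theorem measurable_Gb : Measurable Gb := by
  unfold Gb
  refine Measurable.ite ?_ ?_ ?_
  · exact measurableSet_le (((Quaternion.continuous_imI.measurable).pow_const 2).mul continuous_tvSq.measurable) measurable_const
  · exact ENNReal.measurable_ofReal.comp ((continuous_const.mul (Real.continuous_sqrt.comp continuous_tvSq)).measurable)
  · exact ENNReal.measurable_ofReal.comp (measurable_const.div ((Quaternion.continuous_imI.measurable).abs))

/-- ★ **`vol³(domRef) ≤ ∫ 𝟙_{okRef}·Gb²`**: sections over `(x, y)` lie in `fibre4 x` (volume `≤ Gb x`), and `y` itself ranges over `fibre4 x`. [folklore] -/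
theorem volume_domRef_le_lintegral :
    (((volume : Measure ℍ).prod (volume : Measure ℍ)).prod (volume : Measure ℍ)) domRef ≤ ∫⁻ x, okRef.indicator (fun x => Gb x * Gb x) x := by
  rw [Measure.prod_apply measurableSet_domRef]
  set F : ℍ × ℍ → ℝ≥0∞ := fun q => okRef.indicator (fun _ => (1 : ℝ≥0∞)) q.1 * (Gb q.1 * {q' : ℍ × ℍ | q'.2 ∈ fibre4 q'.1}.indicator 1 q) with hF
  have hFm : Measurable F :=
    ((measurable_const.indicator measurableSet_okRef).comp measurable_fst).mul
      ((measurable_Gb.comp measurable_fst).mul (measurable_const.indicator measurableSet_fibre4_joint))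
  have hsec : ∀ q : ℍ × ℍ, (volume : Measure ℍ) (Prod.mk q ⁻¹' domRef) ≤ F q := by
    rintro ⟨x, y⟩
    by_cases hne : (Prod.mk (x, y) ⁻¹' domRef).Nonempty
    · obtain ⟨z0, hz0⟩ := hne
      obtain ⟨hx, hy, -⟩ := section_domRef hz0
      have hsub : Prod.mk (x, y) ⁻¹' domRef ⊆ fibre4 x := fun z hz => (section_domRef hz).2.2
      have e : F (x, y) = Gb x := by
        simp only [hF, Set.indicator_of_mem (show x ∈ okRef from hx), Set.indicator_of_mem (show (x, y) ∈ {q' : ℍ × ℍ | q'.2 ∈ fibre4 q'.1} from hy),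
          Pi.one_apply, one_mul, mul_one]
      rw [e]; exact (measure_mono hsub).trans (volume_fibre4_le_Gb x)
    · rw [Set.not_nonempty_iff_eq_empty.1 hne, measure_empty]; exact zero_le
  calc ∫⁻ q, (volume : Measure ℍ) (Prod.mk q ⁻¹' domRef) ∂((volume : Measure ℍ).prod (volume : Measure ℍ))
      ≤ ∫⁻ q, F q ∂((volume : Measure ℍ).prod (volume : Measure ℍ)) := lintegral_mono hsec
    _ = ∫⁻ x, ∫⁻ y, F (x, y) := lintegral_prod F hFm.aemeasurable
    _ = ∫⁻ x, okRef.indicator (fun _ => (1 : ℝ≥0∞)) x * (Gb x * volume (fibre4 x)) := by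
        refine lintegral_congr fun x => ?_
        have hm2 : Measurable fun y : ℍ => ({q' : ℍ × ℍ | q'.2 ∈ fibre4 q'.1} : Set (ℍ × ℍ)).indicator (1 : ℍ × ℍ → ℝ≥0∞) (x, y) :=
          (measurable_const.indicator measurableSet_fibre4_joint).comp measurable_prodMk_left
        have hm : Measurable fun y : ℍ => Gb x * {q' : ℍ × ℍ | q'.2 ∈ fibre4 q'.1}.indicator 1 (x, y) := measurable_const.mul hm2
        simp only [hF]
        rw [lintegral_const_mul _ hm, lintegral_const_mul _ hm2]
        congr 2
        have e : (fun y : ℍ => ({q' : ℍ × ℍ | q'.2 ∈ fibre4 q'.1} : Set (ℍ × ℍ)).indicator (1 : ℍ × ℍ → ℝ≥0∞) (x, y)) = (fibre4 x).indicator 1 := by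
          funext y
          by_cases hy : y ∈ fibre4 x
          · rw [Set.indicator_of_mem (show (x, y) ∈ {q' : ℍ × ℍ | q'.2 ∈ fibre4 q'.1} from hy), Set.indicator_of_mem hy]; rfl
          · rw [Set.indicator_of_notMem (show (x, y) ∉ {q' : ℍ × ℍ | q'.2 ∈ fibre4 q'.1} from hy), Set.indicator_of_notMem hy]
        rw [e, lintegral_indicator_one (measurableSet_fibre4 x)]
    _ ≤ ∫⁻ x, okRef.indicator (fun x => Gb x * Gb x) x := by
        refine lintegral_mono fun x => ?_
        by_cases hx : x ∈ okRef
        · rw [Set.indicator_of_mem hx, Set.indicator_of_mem hx, one_mul]; gcongr; exact volume_fibre4_le_Gb x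
        · rw [Set.indicator_of_notMem hx, Set.indicator_of_notMem hx, zero_mul]

/-- The integrand in coordinates: `H(r, (ξ, (J, K))) = 𝟙{r² < 1}·𝟙{J² + K² ≤ 1}·gS(ξ, J² + K²)`. [folklore] -/
def Hcoord (p : ℝ × (ℝ × (ℝ × ℝ))) : ℝ≥0∞ :=
  {r : ℝ | r ^ 2 < 1}.indicator 1 p.1 * ({q : ℝ × ℝ | q.1 ^ 2 + q.2 ^ 2 ≤ 1}.indicator 1 p.2.2 * gS p.2.1 (p.2.2.1 ^ 2 + p.2.2.2 ^ 2))

/-- The transverse disc `{J² + K² ≤ 1}` is measurable. [folklore] -/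
theorem measurableSet_disc : MeasurableSet {q : ℝ × ℝ | q.1 ^ 2 + q.2 ^ 2 ≤ 1} :=
  measurableSet_le ((measurable_fst.pow_const 2).add (measurable_snd.pow_const 2)) measurable_const

/-- The inner coordinate integrand `(ξ, (J, K)) ↦ 𝟙_{disc}(J,K)·gS(ξ, J² + K²)` is measurable. [folklore] -/
theorem measurable_Hinner : Measurable fun q : ℝ × (ℝ × ℝ) => {q : ℝ × ℝ | q.1 ^ 2 + q.2 ^ 2 ≤ 1}.indicator 1 q.2 * gS q.1 (q.2.1 ^ 2 + q.2.2 ^ 2) :=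
  ((measurable_const.indicator measurableSet_disc).comp measurable_snd).mul
    (measurable_gS.comp (measurable_fst.prodMk (((measurable_fst.comp measurable_snd).pow_const 2).add ((measurable_snd.comp measurable_snd).pow_const 2))))

/-- `Hcoord` is measurable. [folklore] -/
theorem measurable_Hcoord : Measurable Hcoord :=
  ((measurable_const.indicator (measurableSet_lt (measurable_id.pow_const 2) measurable_const)).comp measurable_fst).mul
    (measurable_Hinner.comp measurable_snd)

/-- `𝟙_{okRef}·Gb² = Hcoord ∘ coord4`. [folklore] -/
theorem indicator_Gb_sq_eq_Hcoord (x : ℍ) : okRef.indicator (fun x => Gb x * Gb x) x = Hcoord (coord4 x) := by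
  have htv : tvSq x = x.imJ ^ 2 + x.imK ^ 2 := rfl
  simp only [Hcoord, coord4]
  by_cases hx : x ∈ okRef
  · rw [Set.indicator_of_mem hx, Set.indicator_of_mem (show x.re ∈ {r : ℝ | r ^ 2 < 1} from hx.1),
      Set.indicator_of_mem (show (x.imJ, x.imK) ∈ {q : ℝ × ℝ | q.1 ^ 2 + q.2 ^ 2 ≤ 1} from by simpa [htv] using hx.2),
      Pi.one_apply, Pi.one_apply, one_mul, one_mul, Gb_mul_Gb, htv]
  · rw [Set.indicator_of_notMem hx]
    by_cases hr : x.re ^ 2 < 1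
    · have htv1 : ¬ tvSq x ≤ 1 := fun h => hx ⟨hr, h⟩
      rw [Set.indicator_of_notMem (show (x.imJ, x.imK) ∉ {q : ℝ × ℝ | q.1 ^ 2 + q.2 ^ 2 ≤ 1} from by simpa [htv] using htv1), zero_mul, mul_zero]
    · rw [Set.indicator_of_notMem (show x.re ∉ {r : ℝ | r ^ 2 < 1} from hr), zero_mul]

/-- The inner coordinate integral is finite: `∫∫ 𝟙_{disc}·gS ≤ (512 + 1024π)·4`. [folklore] -/
theorem lintegral_Hinner_le :
    ∫⁻ q : ℝ × (ℝ × ℝ), {q : ℝ × ℝ | q.1 ^ 2 + q.2 ^ 2 ≤ 1}.indicator 1 q.2 * gS q.1 (q.2.1 ^ 2 + q.2.2 ^ 2) ≤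
      ENNReal.ofReal (512 + 1024 * π) * ENNReal.ofReal 4 := by
  rw [Measure.volume_eq_prod, lintegral_prod_symm _ measurable_Hinner.aemeasurable]
  have hinner : ∀ JK : ℝ × ℝ, ∫⁻ ξ : ℝ, {q : ℝ × ℝ | q.1 ^ 2 + q.2 ^ 2 ≤ 1}.indicator 1 JK * gS ξ (JK.1 ^ 2 + JK.2 ^ 2) ≤
      (Icc (-1 : ℝ) 1 ×ˢ Icc (-1 : ℝ) 1).indicator (fun _ => ENNReal.ofReal (512 + 1024 * π)) JK := by
    intro JK
    by_cases hJK : JK ∈ {q : ℝ × ℝ | q.1 ^ 2 + q.2 ^ 2 ≤ 1}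
    · have h1 : JK.1 ^ 2 ≤ 1 := by have := hJK; simp only [Set.mem_setOf_eq] at this; nlinarith [sq_nonneg JK.2]
      have h2 : JK.2 ^ 2 ≤ 1 := by have := hJK; simp only [Set.mem_setOf_eq] at this; nlinarith [sq_nonneg JK.1]
      have hbox : JK ∈ Icc (-1 : ℝ) 1 ×ˢ Icc (-1 : ℝ) 1 := by
        have a1 := mem_Icc_of_sq_le h1; have a2 := mem_Icc_of_sq_le h2
        rw [Real.sqrt_one] at a1 a2
        exact ⟨a1, a2⟩
      rw [Set.indicator_of_mem hbox]
      simp only [Set.indicator_of_mem hJK, Pi.one_apply, one_mul]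
      refine (lintegral_gS_le (by positivity)).trans (ENNReal.ofReal_le_ofReal ?_)
      have hs : Real.sqrt (JK.1 ^ 2 + JK.2 ^ 2) ≤ 1 := by
        rw [← Real.sqrt_one]; exact Real.sqrt_le_sqrt (by simpa using hJK)
      nlinarith [Real.pi_pos, Real.sqrt_nonneg (JK.1 ^ 2 + JK.2 ^ 2)]
    · simp only [Set.indicator_of_notMem hJK, zero_mul, lintegral_zero]; exact zero_le
  calc _ ≤ ∫⁻ JK : ℝ × ℝ, (Icc (-1 : ℝ) 1 ×ˢ Icc (-1 : ℝ) 1).indicator (fun _ => ENNReal.ofReal (512 + 1024 * π)) JK := lintegral_mono hinner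
    _ = ENNReal.ofReal (512 + 1024 * π) * volume (Icc (-1 : ℝ) 1 ×ˢ Icc (-1 : ℝ) 1) := by
        rw [lintegral_indicator (measurableSet_Icc.prod measurableSet_Icc), setLIntegral_const]
    _ = ENNReal.ofReal (512 + 1024 * π) * ENNReal.ofReal 4 := by
        rw [Measure.volume_eq_prod, Measure.prod_prod, Real.volume_Icc, ← ENNReal.ofReal_mul (by norm_num)]; norm_num

/-- ★ `∫ 𝟙_{okRef}·Gb² ≤ 2·(512 + 1024π)·4 < ∞`. [folklore] -/
theorem lintegral_indicator_Gb_sq_le :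
    ∫⁻ x, okRef.indicator (fun x => Gb x * Gb x) x ≤ ENNReal.ofReal 2 * (ENNReal.ofReal (512 + 1024 * π) * ENNReal.ofReal 4) := by
  have e : (fun x : ℍ => okRef.indicator (fun x => Gb x * Gb x) x) = fun x => Hcoord (coord4 x) := funext indicator_Gb_sq_eq_Hcoord
  rw [e, lintegral_eq_lintegral_coord4 Hcoord measurable_Hcoord, Measure.volume_eq_prod]
  simp only [Hcoord]
  rw [lintegral_prod _ (by
    exact (((measurable_const.indicator (measurableSet_lt (measurable_id.pow_const 2) measurable_const)).comp measurable_fst).mul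
      (measurable_Hinner.comp measurable_snd)).aemeasurable)]
  have hr : ∀ r : ℝ, ∫⁻ q : ℝ × (ℝ × ℝ), {r : ℝ | r ^ 2 < 1}.indicator 1 r *
      ({q : ℝ × ℝ | q.1 ^ 2 + q.2 ^ 2 ≤ 1}.indicator 1 q.2 * gS q.1 (q.2.1 ^ 2 + q.2.2 ^ 2)) ≤
      (Ioo (-1 : ℝ) 1).indicator (fun _ => ENNReal.ofReal (512 + 1024 * π) * ENNReal.ofReal 4) r := by
    intro r
    rw [lintegral_const_mul _ measurable_Hinner]
    by_cases h : r ∈ {r : ℝ | r ^ 2 < 1}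
    · have hab : |r| < 1 := (sq_lt_one_iff_abs_lt_one r).1 h
      have hI : r ∈ Ioo (-1 : ℝ) 1 := ⟨by linarith [(abs_lt.1 hab).1], (abs_lt.1 hab).2⟩
      rw [Set.indicator_of_mem h, Set.indicator_of_mem hI, Pi.one_apply, one_mul]
      exact lintegral_Hinner_le
    · rw [Set.indicator_of_notMem h, zero_mul]; exact zero_le
  calc _ ≤ ∫⁻ r : ℝ, (Ioo (-1 : ℝ) 1).indicator (fun _ => ENNReal.ofReal (512 + 1024 * π) * ENNReal.ofReal 4) r := lintegral_mono hr
    _ = _ := by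
        rw [lintegral_indicator measurableSet_Ioo, setLIntegral_const, Real.volume_Ioo, show (1 : ℝ) - -1 = 2 by norm_num, mul_comm]

/-- ★★ **THE MAJORANT HAS FINITE VOLUME**: `vol³(domSet4) < ∞`. [folklore] -/
theorem volume_domSet4_lt_top : (((volume : Measure ℍ).prod (volume : Measure ℍ)).prod (volume : Measure ℍ)) domSet4 < ∞ := by
  have hR : (((volume : Measure ℍ).prod (volume : Measure ℍ)).prod (volume : Measure ℍ)) domRef < ∞ :=
    lt_of_le_of_lt (volume_domRef_le_lintegral.trans lintegral_indicator_Gb_sq_le)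
      (ENNReal.mul_lt_top ENNReal.ofReal_lt_top (ENNReal.mul_lt_top ENNReal.ofReal_lt_top ENNReal.ofReal_lt_top))
  refine lt_of_le_of_lt volume_domSet4_le ?_
  exact ENNReal.add_lt_top.2 ⟨ENNReal.add_lt_top.2 ⟨hR, hR⟩, hR⟩

/-- ★★ **UNIFORM BOUND for the two-scale family**: `vol³(T(η, ζ, κ)) ≤ vol³(domSet4)` for all `η, ζ, κ ≥ 0`. [folklore] -/
theorem volume_twoScaleSet4_le_domSet4 {η ζ κ : ℝ} (hη : 0 ≤ η) (hζ : 0 ≤ ζ) (hκ : 0 ≤ κ) :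
    (((volume : Measure ℍ).prod (volume : Measure ℍ)).prod (volume : Measure ℍ)) (twoScaleSet4 η ζ κ) ≤
      (((volume : Measure ℍ).prod (volume : Measure ℍ)).prod (volume : Measure ℍ)) domSet4 :=
  measure_mono (twoScaleSet4_subset_domSet4 hη hζ hκ)

/-- ★★ In particular every `T(η, ζ, κ)` (`η, ζ, κ ≥ 0`) — and the limit events `T(0, 0, κ)` whose volumes `h(κ)` carry the coefficient of the
logarithm — has FINITE volume. [folklore] -/
theorem volume_twoScaleSet4_lt_top {η ζ κ : ℝ} (hη : 0 ≤ η) (hζ : 0 ≤ ζ) (hκ : 0 ≤ κ) :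
    (((volume : Measure ℍ).prod (volume : Measure ℍ)).prod (volume : Measure ℍ)) (twoScaleSet4 η ζ κ) < ∞ :=
  lt_of_le_of_lt (volume_twoScaleSet4_le_domSet4 hη hζ hκ) volume_domSet4_lt_top

end Summit.QuantumFields.YangMills.Theorems.SwapVirialDeficit.ZeroModeGroup

end
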